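/-
Copyright: statement-level skeleton of a published paper (lit-balaban cell, Phase-2 proof seat p25, gen 20). No proof
claims beyond what the kernel checks below.
-/
import Literature.MathematicalPhysics.QuantumFieldTheory.BalabanImbrieJaffe1984to88.BIJ88WalkRemainderMoments312

/-!
# `BalabanImbrieJaffe1984to88.BIJ88WalkProductCutoff312` — T. Bałaban, J. Imbrie, A. Jaffe, *Effective action and
cluster properties of the abelian Higgs model*, Commun. Math. Phys. **114** (1988) 257–315 [BalabanImbrieJaffe1988],
§5.2 p. 278 [PDF 22] (x2 render `lit-balaban-r16/renders/cmp114/original-p022-x2.png`, read 2026-08-23), verbatim: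
the small-field characteristic functions are PRODUCTS of one-variable factors: *"We insert a partition of unity under
the integrals: 1 = Σ_{P_x⊂Λ₁₃^{(k−1)′}} Σ_{P_y⊂Λ₁₃^{(k−1)″}} Σ_{P_b⊂Λ₁₃^{(k−1)′*}} Σ_{P_p⊂Λ₁₃^{(k−1)′**}}
× Π_{x∈P_x} χ^c_x Π_{x∈Λ₁₃^{(k−1)′}∖P_x} χ_x Π_{y∈P_y} χ^c_y Π_{y∈Λ₁₃^{(k−1)″}∖P_y} χ_y
× Π_{b∈P_b} χ^c_b Π_{b∈Λ₁₃^{(k−1)′*}∖P_b} χ_b Π_{p∈P_p} χ^c_p Π_{p∈Λ₁₃^{(k−1)′**}∖P_p} χ_p, (5.2.1)"* with (5.2.2)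
*"χ_y = χ(p(e_k), |(ψ − Q(u_k)φ)(y)|) = 1 − χ^c_y, χ_b = χ(p(e_k), |(D_{ū_k}φ)(b)|) = 1 − χ^c_b, χ_p = χ(e_kp(e_k), |u(p) − 1|)
= 1 − χ^c_p"*, each factor a fixed profile of a LINEAR functional of the fields scaled by `p(e_k)`: *"The function χ(p, x) is defined as follows: We let χ(1, x) be an even, C^∞ function,
equal to zero for |x| ≧ 1, and equal to one for |x| ≦ 9/10, and with |dⁿ/dxⁿ χ(1, x)| ≦ cⁿn^{cn} for all n, x. (5.2.3)
Then we put χ(p, x) = χ(1, x/p). (5.2.4)"* (typed by r18 as `BIJ88Sect5Statements.CutoffProfile`, inhabited by p04's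
`BIJ88CutoffProfileWitness.gevreyCutoff`); and §5.14 p. 309 [PDF 53] (render p053) *"and similarly the n-th
derivative in t of χ(cp(e_k), A^{(k)}) is bounded by t^{−n} times a function bounded by a constant …"*, p. 312 [PDF 56]
the estimate preceding (5.14.5).

**THE SUP LETTER `K_χ/η_χ` OF CLAUSE C3 DISCHARGED FOR PRINT'S PRODUCT CUTOFFS** (p25 gen 20; a MEMBER of row
C2.Claim@312 — the head theorem `BIJ88WalkIneq312RemainderBdry.ineq312_remainder_bdry` (r16 v2.284) is USED BY NAME
with its cutoff letter INSTANTIATED: `χ(Φ) = Π_{b∈B} χ₁(ℓ_b(Φ)/p)` for a finite family of linear functionals `ℓ_b` of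
norm `≤ 1` (sup norm on the fields) and a profile `χ₁` with the printed derivative condition (5.2.3)).  The mechanism
is the Leibniz rule over the factors: if `|χ₁^{(k)}| ≤ a^k` for `k ≤ N` then the `n`-th Fréchet derivative of the
product has multilinear norm `≤ (#B·a)^n` (`n ≤ N`) — so gen 19's scaled-cutoff route (`BIJ88WalkScaledCutoff309`,
`BIJ88WalkDirectionCount312.remainder_expectation_le_scaled_phi0`: `≤ Φ₀(O)` directions per term) applies with
`K = (max 1 (#B·a_O))^{Φ₀(O)}`, `a_O = max(1,c)·max(1,Φ₀(O))^c`, `η_χ = 1/p`, and the moment letter is gen 20's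
`BIJ88WalkRemainderMoments312.remainder_moment_le`.

* §1 (multilinear calculus, [folklore]) `norm_iteratedFDeriv_comp_clm_le` (`‖D^k(g∘ℓ)(Φ)‖ ≤ |g^{(k)}(ℓΦ)|` for
  `‖ℓ‖ ≤ 1`), `norm_proj_le_one`, **`norm_iteratedFDeriv_prod_le`** (`‖D^n Π_{b∈B} g(ℓ_bΦ)‖ ≤ (#B·a)^n`, `n ≤ N`);
* §2 (5.2.3) bookkeeping: `nonneg_of_derivBound` (`c ≥ 0`), **`derivBound_le_pow`** (`cⁿn^{cn} ≤ a_Nⁿ` for `n ≤ N`,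
  `a_N = max(1,c)·max(1,N)^c`), `prodCutoff_eq_scaled` (`Π_b χ₁(p⁻¹ℓ_bψ) = h(p⁻¹•ψ)`, `h = Π_b χ₁∘ℓ_b`);
* §3 **`prodCutoff_hE`** — the head's expectation clause `hE` for `χ = Π_b χ₁(ℓ_b/p)` on the §5.13 law, DERIVED:
  `K_χ = K_V` (the sup letter of `e^{−V}` alone), `η_χ = p⁻¹`, `Λ_O = (max 1 (#B·a_{Φ₀(O)}))^{Φ₀(O)} · Λ_O^{mom}`;
* §4 **`ineq312_remainder_bdry_prodCutoff`** — the head theorem with `χ`, `K_χ`, `η_χ`, `Λ` so instantiated: of the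
  head's clause C3 only the sup of `e^{−V}` (`K_V`) and the legs' moment letters `μ_*, v_*` remain;
* §5 **`ineq312_remainder_bdry_prodCutoff_toy`** — KERNEL NON-VACUITY WITH A REAL CUTOFF: every hypothesis of §4
  discharged on the one-site toy of `BIJ88WalkIneq312NonVacuity` for ANY printed profile `χ₁ : CutoffProfile`, except
  the profile's own (5.2.3) letter (gen 19's open item *"a toy with a REAL cutoff"*).

statement-level skeleton of published theorems with citation tags; proofs where landed; nothing here is a claim
about the Yang–Mills mass gap

PDF held: `paper:balaban1988-cmp114-bij-abelian-higgs-effective-action` (journal page = PDF page + 256); p. 278 from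
the x2 render as quoted; pp. 309, 312 as in the sibling files.

CITATION HEADER (lean-in-tree rule).  lit-balaban cell (HOME `run/shared/lean/pub/lit-balaban/`), Phase 2, seat p25
gen 20; row **C2.Claim@312** of `HOME/lit-balaban-r16/ROWS-C2-part2.md` (owner r16, referee ref-5; head theorem of
record UNCHANGED and USED BY NAME; this file is a MEMBER — clause C3's cutoff letter instantiated on print's product
cutoffs).  Nothing restated.
HONEST SCOPE: (a) the VOLUME of the cutoff enters `c_F` through `(#B·a_O)^{Φ₀(O)}` — polynomial in the number `#B` of
cutoff factors carried by the located family (print absorbs such growth into *"adjustments in β, α, β′"*, p. 310; not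
done here); (b) `K_V ≥ sup|e^{−V}|` stays a letter (print: positivity of the action), as do the legs' moment letters;
(c) the profile enters only through (5.2.3) and smoothness — evenness and the plateaus `= 1`/`= 0` are not used by
the bound; the absolute value inside print's `χ(p, |ℓ(Φ)|)` is immaterial for an even profile and is dropped; (d)
everything else as in the head ((H1)–(H5)).  NOT summit progress; NOT continuum; NOT Clay.  Imports
`BIJ88WalkRemainderMoments312` (p25 g20); modifies nothing; 0 `sorry`, 0 definitions, 0 `Prop` facts.
-/

noncomputable section

namespace Literature.MathematicalPhysics.QuantumFieldTheory.BalabanImbrieJaffe1984to88.BIJ88WalkProductCutoff312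

open Classical MeasureTheory Matrix Finset
open scoped BigOperators ContDiff
open Literature.MathematicalPhysics.QuantumFieldTheory.Balaban1983to89
open B2Eq228Conditioning (weight source)
open BIJ88PolymerRep5134 (corner)
open BIJ88PolymerRep5134Gauss (prec src)
open BIJ88SlotMomentsGauss308 (fieldLaw)
open BIJ88VertexIbp311 (vexp)
open BIJ88WickDerivatives305 (dlist)
open BIJ88WalkRun311 BIJ88WalkExpansion311 BIJ88WalkRemainderActivity312 BIJ88WalkIneq312Remainder
  BIJ88WalkIneq312RemainderBdry BIJ88WalkDirectionCount312 BIJ88WalkRemainderMoments312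

/-! ## §1  Leibniz over the cutoff factors -/

section Calculus

variable {S : Type} [Fintype S]

/-- derivatives of one factor: for a linear functional `ℓ` of norm `≤ 1`, `‖D^k(g ∘ ℓ)(Φ)‖ ≤ |g^{(k)}(ℓΦ)|`.
[folklore] [cite: BalabanImbrieJaffe1988, (5.2.2) p.278] -/
theorem norm_iteratedFDeriv_comp_clm_le {g : ℝ → ℝ} (hg : ContDiff ℝ ∞ g) {ℓ : (S → ℝ) →L[ℝ] ℝ} (hℓ : ‖ℓ‖ ≤ 1)
    (k : ℕ) (Φ : S → ℝ) : ‖iteratedFDeriv ℝ k (fun Φ : S → ℝ => g (ℓ Φ)) Φ‖ ≤ ‖iteratedDeriv k g (ℓ Φ)‖ := by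
  have hfun : (fun Φ : S → ℝ => g (ℓ Φ)) = g ∘ ℓ := rfl
  rw [hfun, ℓ.iteratedFDeriv_comp_right hg Φ (mod_cast le_top), ← norm_iteratedFDeriv_eq_norm_iteratedDeriv]
  refine (ContinuousMultilinearMap.norm_compContinuousLinearMap_le _ _).trans ?_
  exact mul_le_of_le_one_right (norm_nonneg _) (Finset.prod_le_one (fun _ _ => norm_nonneg _) fun _ _ => hℓ)

/-- the site projections `Φ ↦ Φ_y` have norm `≤ 1` (sup norm). [folklore] [cite: BalabanImbrieJaffe1988, (5.2.2) p.278] -/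
theorem norm_proj_le_one (y : S) : ‖(ContinuousLinearMap.proj y : (S → ℝ) →L[ℝ] ℝ)‖ ≤ 1 :=
  ContinuousLinearMap.opNorm_le_bound _ zero_le_one fun Φ => by
    rw [one_mul]; exact norm_le_pi_norm Φ y

/-- **LEIBNIZ OVER THE FACTORS**: if `|g^{(k)}| ≤ a^k` for all `k ≤ N` (`a ≥ 0`; at `k = 0`: `|g| ≤ 1`) and `‖ℓ_b‖ ≤ 1`,
then `‖D^n Π_{b∈B} g(ℓ_bΦ)‖ ≤ (#B·a)^n` for all `n ≤ N` (multilinear operator norm w.r.t. the sup norm on `S → ℝ`):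
induction on `B` with `‖D^n(fF)‖ ≤ Σ_i C(n,i)‖D^if‖‖D^{n−i}F‖` and the binomial theorem.
[folklore] [cite: BalabanImbrieJaffe1988, (5.2.1)-(5.2.3) p.278] -/
theorem norm_iteratedFDeriv_prod_le {B : Type} {g : ℝ → ℝ} (hg : ContDiff ℝ ∞ g) {a : ℝ} (ha : 0 ≤ a) {N : ℕ}
    (hga : ∀ k ≤ N, ∀ t, ‖iteratedDeriv k g t‖ ≤ a ^ k) {ℓ : B → (S → ℝ) →L[ℝ] ℝ} (hℓ : ∀ b, ‖ℓ b‖ ≤ 1)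
    (Bs : Finset B) :
    ∀ n ≤ N, ∀ Φ : S → ℝ, ‖iteratedFDeriv ℝ n (fun Φ : S → ℝ => ∏ b ∈ Bs, g (ℓ b Φ)) Φ‖ ≤ ((Bs.card : ℝ) * a) ^ n := by
  induction Bs using Finset.induction_on with
  | empty =>
    intro n _ Φ
    simp only [Finset.prod_empty, Finset.card_empty, Nat.cast_zero, zero_mul]
    rcases Nat.eq_zero_or_pos n with rfl | hpos
    · rw [pow_zero, norm_iteratedFDeriv_zero, norm_one]
    · rw [iteratedFDeriv_const_of_ne hpos.ne', Pi.zero_apply, norm_zero, zero_pow hpos.ne']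
  | insert y s hy ih =>
    intro n hn Φ
    have hf : ContDiff ℝ ∞ (fun Φ : S → ℝ => g (ℓ y Φ)) := hg.comp (ℓ y).contDiff
    have hF : ContDiff ℝ ∞ (fun Φ : S → ℝ => ∏ b ∈ s, g (ℓ b Φ)) := contDiff_prod fun b _ => hg.comp (ℓ b).contDiff
    simp only [Finset.prod_insert hy]
    refine (norm_iteratedFDeriv_mul_le hf hF Φ (mod_cast le_top)).trans ?_
    rw [Finset.card_insert_of_notMem hy, Nat.cast_succ]
    calc ∑ i ∈ Finset.range (n + 1), (n.choose i : ℝ) * ‖iteratedFDeriv ℝ i (fun Φ : S → ℝ => g (ℓ y Φ)) Φ‖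
          * ‖iteratedFDeriv ℝ (n - i) (fun Φ : S → ℝ => ∏ b ∈ s, g (ℓ b Φ)) Φ‖
        ≤ ∑ i ∈ Finset.range (n + 1), (n.choose i : ℝ) * a ^ i * ((s.card : ℝ) * a) ^ (n - i) := by
          refine Finset.sum_le_sum fun i hi => ?_
          have hi' : i ≤ n := Nat.lt_succ_iff.mp (Finset.mem_range.mp hi)
          exact mul_le_mul (mul_le_mul_of_nonneg_left ((norm_iteratedFDeriv_comp_clm_le hg (hℓ y) i Φ).trans
            (hga i (hi'.trans hn) _)) (Nat.cast_nonneg _)) (ih (n - i) ((Nat.sub_le n i).trans hn) Φ)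
            (norm_nonneg _) (mul_nonneg (Nat.cast_nonneg _) (pow_nonneg ha _))
      _ = (a + (s.card : ℝ) * a) ^ n := by
          rw [add_pow]; exact Finset.sum_congr rfl fun i _ => by ring
      _ = (((s.card : ℝ) + 1) * a) ^ n := by ring

end Calculus

/-! ## §2  The printed derivative condition (5.2.3) up to a finite order -/

section Profile

/-- the constant of (5.2.3) is `≥ 0` (take `n = 1`). [cite: BalabanImbrieJaffe1988, (5.2.3) p.278] -/
theorem nonneg_of_derivBound {g : ℝ → ℝ} {c : ℝ} (hgc : ∀ (n : ℕ) (x : ℝ), |iteratedDeriv n g x| ≤ c ^ n * (n : ℝ) ^ (c * n)) :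
    0 ≤ c := by
  have h := hgc 1 0
  rw [pow_one, Nat.cast_one, Real.one_rpow, mul_one] at h
  exact (abs_nonneg _).trans h

/-- **(5.2.3) up to order `N`**: `|χ₁^{(k)}| ≤ cᵏk^{ck} ≤ a_Nᵏ` for `k ≤ N`, with `a_N := max(1,c)·max(1,N)^c`.
[cite: BalabanImbrieJaffe1988, (5.2.3) p.278] -/
theorem derivBound_le_pow {g : ℝ → ℝ} {c : ℝ} (hgc : ∀ (n : ℕ) (x : ℝ), |iteratedDeriv n g x| ≤ c ^ n * (n : ℝ) ^ (c * n))
    (N : ℕ) : ∀ k ≤ N, ∀ t, ‖iteratedDeriv k g t‖ ≤ (max 1 c * (max 1 (N : ℝ)) ^ c) ^ k := by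
  intro k hk t
  have hc := nonneg_of_derivBound hgc
  have h1 : (0 : ℝ) ≤ max 1 (N : ℝ) := zero_le_one.trans (le_max_left _ _)
  rw [Real.norm_eq_abs, mul_pow]
  refine (hgc k t).trans (mul_le_mul (pow_le_pow_left₀ hc (le_max_right _ _) k) ?_
    (Real.rpow_nonneg (Nat.cast_nonneg _) _) (pow_nonneg (zero_le_one.trans (le_max_left _ _)) _))
  rw [← Real.rpow_natCast ((max 1 (N : ℝ)) ^ c) k, ← Real.rpow_mul h1]
  rcases Nat.eq_zero_or_pos k with rfl | hpos
  · simp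
  · exact Real.rpow_le_rpow (Nat.cast_nonneg _) ((Nat.cast_le.mpr hk).trans (le_max_right _ _))
      (mul_nonneg hc (Nat.cast_nonneg _))

end Profile

/-! ## §3  The expectation clause `hE` for product cutoffs, derived -/

section Law

variable {ι : Type} [Fintype ι] {κ : Type} [LinearOrder κ] {P : Type} [Fintype P] {β : Type} [DecidableEq β]
variable {α I : Type} [Fintype α] [DecidableEq α] [Fintype I] [DecidableEq I]
  {blk : α → I} {Δ : Matrix α α ℝ} {ℱ : α → ℝ} {W : Finset I}

/-- the scaled product cutoff is the scaled-cutoff shape of `BIJ88WalkScaledCutoff309`: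
`Π_b χ₁(p⁻¹·ℓ_b ψ) = h(p⁻¹ • ψ)` with `h(Φ) = Π_b χ₁(ℓ_b Φ)`. [cite: BalabanImbrieJaffe1988, (5.2.4) p.278] -/
theorem prodCutoff_eq_scaled {S : Type} {B : Type} (Bs : Finset B) (ℓ : B → (S → ℝ) →L[ℝ] ℝ) (g : ℝ → ℝ) (p : ℝ) :
    (fun ψ : S → ℝ => ∏ b ∈ Bs, g (p⁻¹ * ℓ b ψ)) = fun ψ => (fun Φ : S → ℝ => ∏ b ∈ Bs, g (ℓ b Φ)) (p⁻¹ • ψ) := by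
  funext ψ; simp only [map_smul, smul_eq_mul]

/-- **THE HEAD'S EXPECTATION CLAUSE FOR PRINT'S PRODUCT CUTOFFS, DERIVED** on the §5.13 law: for
`χ(ψ) = Π_{b∈B} χ₁(ℓ_b(ψ)/p)` (`‖ℓ_b‖ ≤ 1`, `χ₁` with (5.2.3)), every no-block term `t` of `expand 0 O` satisfies
`|𝔼_W[Π_{pending}(Φ·w)·(Π_{z∈dirs t}∂_z)χ·e^{−V}]| ≤ K_V·Π_{z}(p⁻¹‖z‖)·(max 1 (#B·a_{Φ₀(O)}))^{Φ₀(O)}·Λ_O^{mom}` —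
gen 19's scaled-cutoff route (`≤ Φ₀(O)` directions per term) with §1–§2 for the derivative letter and gen 20's
`remainder_moment_le` for the moments. [cite: BalabanImbrieJaffe1988, §5.14 p.312; p.309; (5.2.3)-(5.2.4) p.278] -/
theorem prodCutoff_hE (hPD : (prec blk Δ W (corner ℝ W)).PosDef)
    {Cov : P → Matrix {x : α // blk x ∈ W} {x : α // blk x ∈ W} ℝ} {trig : P → Bool} {c : ι → ℝ}
    {legs : ι → List ({x : α // blk x ∈ W} → ℝ)} {obs : κ → List ({x : α // blk x ∈ W} → ℝ)} {M : ℕ}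
    {B : Type} (Bs : Finset B) {ℓ : B → ({x : α // blk x ∈ W} → ℝ) →L[ℝ] ℝ} (hℓ : ∀ b, ‖ℓ b‖ ≤ 1)
    {g : ℝ → ℝ} (hg : ContDiff ℝ ∞ g) {cg : ℝ}
    (hgc : ∀ (n : ℕ) (x : ℝ), |iteratedDeriv n g x| ≤ cg ^ n * (n : ℝ) ^ (cg * n))
    {KV p μs vs : ℝ} (hV : ∀ φ, |vexp c legs φ| ≤ KV) (hp : 0 < p) (hμs : 0 ≤ μs) (hvs : 0 ≤ vs)
    (hobs : ∀ j, ∀ w ∈ obs j, |w ⬝ᵥ ((prec blk Δ W (corner ℝ W))⁻¹ *ᵥ src blk ℱ W)| ≤ μs ∧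
      w ⬝ᵥ ((prec blk Δ W (corner ℝ W))⁻¹ *ᵥ w) ≤ vs)
    (hlegs : ∀ m, ∀ w ∈ legs m, |w ⬝ᵥ ((prec blk Δ W (corner ℝ W))⁻¹ *ᵥ src blk ℱ W)| ≤ μs ∧
      w ⬝ᵥ ((prec blk Δ W (corner ℝ W))⁻¹ *ᵥ w) ≤ vs) :
    ∀ O : Finset κ, ∀ t ∈ expand Cov trig (src blk ℱ W) c legs obs M 0 O, t.consts = 0 →
      |∫ φ, ((t.groups.map fun h => (h.pend : Multiset _)).sum.map fun w => φ ⬝ᵥ w).prod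
          * (dlist t.dirs (fun ψ => ∏ b ∈ Bs, g (p⁻¹ * ℓ b ψ)) φ * vexp c legs φ) ∂(fieldLaw blk Δ ℱ W)|
        ≤ KV * (t.dirs.map fun z => p⁻¹ * ‖z‖).prod
          * ((max 1 ((Bs.card : ℝ) * (max 1 cg * (max 1 (phi0 legs obs M O : ℝ)) ^ cg))) ^ phi0 legs obs M O
            * ∑ N ∈ range (phi0 legs obs M O + 1), 2 ^ N * (μs ^ N + (1 + vs ^ N * ((2 * N - 1).doubleFactorial : ℝ)))) := by
  intro O t ht h0
  have ha0 : 0 ≤ max 1 cg * (max 1 (phi0 legs obs M O : ℝ)) ^ cg :=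
    mul_nonneg (zero_le_one.trans (le_max_left _ _)) (Real.rpow_nonneg (zero_le_one.trans (le_max_left _ _)) _)
  have hK0 : 0 ≤ (max 1 ((Bs.card : ℝ) * (max 1 cg * (max 1 (phi0 legs obs M O : ℝ)) ^ cg))) ^ phi0 legs obs M O :=
    pow_nonneg (zero_le_one.trans (le_max_left _ _)) _
  have hKn : ∀ n ≤ phi0 legs obs M O, ∀ φ,
      ‖iteratedFDeriv ℝ n (fun Φ : {x : α // blk x ∈ W} → ℝ => ∏ b ∈ Bs, g (ℓ b Φ)) φ‖
        ≤ (max 1 ((Bs.card : ℝ) * (max 1 cg * (max 1 (phi0 legs obs M O : ℝ)) ^ cg))) ^ phi0 legs obs M O :=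
    fun n hn φ => (norm_iteratedFDeriv_prod_le hg ha0 (derivBound_le_pow hgc _) hℓ Bs n hn φ).trans
      ((pow_le_pow_left₀ (mul_nonneg (Nat.cast_nonneg _) ha0) (le_max_right _ _) n).trans
        (pow_le_pow_right₀ (le_max_left _ _) hn))
  have hh : ContDiff ℝ ∞ (fun Φ : {x : α // blk x ∈ W} → ℝ => ∏ b ∈ Bs, g (ℓ b Φ)) :=
    contDiff_prod fun b _ => hg.comp (ℓ b).contDiff
  rw [prodCutoff_eq_scaled Bs ℓ g p]
  refine (remainder_expectation_le_scaled_phi0 hPD hh hK0 hKn hV hp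
    (remainder_moment_le blk Δ ℱ W hPD hμs hvs hobs hlegs O) t ht h0).trans (le_of_eq ?_)
  ring

/-! ## §4  The head theorem with the cutoff letter instantiated on product cutoffs -/

/-- **THE HEAD THEOREM OF ROW C2.Claim@312 FOR PRINT'S PRODUCT CUTOFFS**:
`BIJ88WalkIneq312RemainderBdry.ineq312_remainder_bdry` with `χ := Π_{b∈B} χ₁(ℓ_b/p)` ((5.2.1)–(5.2.4): profile `χ₁`
with (5.2.3), linear functionals `‖ℓ_b‖ ≤ 1`, scale `p ≥ 1`), `K_χ := K_V` (`|e^{−V}| ≤ K_V`), `η_χ := p⁻¹`,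
`Λ_O := (max 1 (#B·a_{Φ₀(O)}))^{Φ₀(O)}·Σ_{N≤Φ₀(O)}2^N(μ_*^N + 1 + v_*^N(2N−1)‼)`; the clause `hE` is DISCHARGED (§3),
`hη0`, `hη1`, `hKχ`, `hΛ` likewise; all other clauses verbatim the head's.  Conclusion verbatim the head's.
[cite: BalabanImbrieJaffe1988, §5.14 p.312 (estimate preceding (5.14.5)); (5.2.1)-(5.2.4) p.278] -/
theorem ineq312_remainder_bdry_prodCutoff (hPD : (prec blk Δ W (corner ℝ W)).PosDef)
    {Cov : P → Matrix {x : α // blk x ∈ W} {x : α // blk x ∈ W} ℝ} {trig : P → Bool} {c : ι → ℝ}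
    {legs : ι → List ({x : α // blk x ∈ W} → ℝ)} {obs : κ → List ({x : α // blk x ∈ W} → ℝ)} {M : ℕ}
    {oc : κ → Finset β} {vc : ι → Finset β} {reg : P → Finset β}
    {Dir : Set ({x : α // blk x ∈ W} → ℝ)} {B' ρ : P → ℝ} {cV : ι → ℝ} {Bl θ θv θw ρ₀ : ℝ} {N₀ : ℕ}
    {B : Type} (Bs : Finset B) {ℓ : B → ({x : α // blk x ∈ W} → ℝ) →L[ℝ] ℝ} (hℓ : ∀ b, ‖ℓ b‖ ≤ 1)
    {g : ℝ → ℝ} (hg : ContDiff ℝ ∞ g) {cg : ℝ}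
    (hgc : ∀ (n : ℕ) (x : ℝ), |iteratedDeriv n g x| ≤ cg ^ n * (n : ℝ) ^ (cg * n))
    {KV p μs vs : ℝ} (hV : ∀ φ, |vexp c legs φ| ≤ KV) (hp1 : 1 ≤ p) (hμs : 0 ≤ μs) (hvs : 0 ≤ vs)
    (hobsm : ∀ j, ∀ w ∈ obs j, |w ⬝ᵥ ((prec blk Δ W (corner ℝ W))⁻¹ *ᵥ src blk ℱ W)| ≤ μs ∧
      w ⬝ᵥ ((prec blk Δ W (corner ℝ W))⁻¹ *ᵥ w) ≤ vs)
    (hlegsm : ∀ m, ∀ w ∈ legs m, |w ⬝ᵥ ((prec blk Δ W (corner ℝ W))⁻¹ *ᵥ src blk ℱ W)| ≤ μs ∧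
      w ⬝ᵥ ((prec blk Δ W (corner ℝ W))⁻¹ *ᵥ w) ≤ vs)
    (hθ0 : 0 < θ) (hθ1 : θ ≤ 1) (hBl : 1 ≤ Bl) (hB0 : ∀ p, 0 ≤ B' p) (hρ : ∀ p, 0 ≤ ρ p) (hcV0 : ∀ m, 0 ≤ cV m)
    (hθv : 0 < θv) (hθv1 : θv ≤ 1) (hθw : 0 < θw) (hθw1 : θw ≤ 1)
    (hB : ∀ p, ∀ u ∈ Dir, ∀ w ∈ Dir, |(Cov p *ᵥ u) ⬝ᵥ w| ≤ B' p * ρ p)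
    (hBf : ∀ p, ∀ u ∈ Dir, |(Cov p *ᵥ u) ⬝ᵥ src blk ℱ W| ≤ B' p * ρ p)
    (hBz : ∀ p, ∀ u ∈ Dir, ‖Cov p *ᵥ u‖ ≤ B' p * ρ p)
    (hcV : ∀ m, |c m| ≤ cV m) (hobs : ∀ j, ∀ w ∈ obs j, w ∈ Dir) (hlegs : ∀ m, ∀ w ∈ legs m, w ∈ Dir)
    (hloc : ∀ p, trig p = false → B' p ≤ Bl ∧ reg p = ∅) (hwalk : ∀ p, trig p = true → B' p ≤ θw * θ ^ (reg p).card)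
    (hvert : ∀ m, cV m * Bl ^ (legs m).length ≤ θv * θ ^ (vc m).card) (hρ₀0 : 0 ≤ ρ₀)
    (hρ₀ : ∀ u ∈ Dir, (∑ p ∈ univ.filter (fun p => Cov p *ᵥ u ≠ 0), ρ p) ≤ ρ₀)
    (hN : ∀ p, ∀ u ∈ Dir,
      (∑ m, ((range (legs m).length).filter fun j => (Cov p *ᵥ u) ⬝ᵥ (legs m).getD j 0 ≠ 0).card) ≤ N₀)
    (bdry : Finset κ)
    (hbeat : ∀ O : Finset κ, ∀ t ∈ expand Cov trig (src blk ℱ W) c legs obs M 0 O, t.consts = 0 → ∀ X ∈ t.groups,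
      max p⁻¹ (max (θv ^ M) θw) * ∏ j ∈ X.lab.filter (fun j => j ∉ bdry), Bl ^ (obs j).length ≤ 1) :
    BIJ88Sect5StatementsPart4.Ineq312 (remSys κ β)
      (fun OX => remAt (prec blk Δ W (corner ℝ W)) Cov trig (src blk ℱ W) c legs obs M
        (fun ψ => ∏ b ∈ Bs, g (p⁻¹ * ℓ b ψ)) oc vc reg [] 0 OX.1 OX.2
        / ∫ φ, weight (prec blk Δ W (corner ℝ W)) φ * source (src blk ℱ W) φ)
      (fun OX => KV * ((max 1 ((Bs.card : ℝ) * (max 1 cg * (max 1 (phi0 legs obs M OX.1 : ℝ)) ^ cg))) ^ phi0 legs obs M OX.1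
            * ∑ N ∈ range (phi0 legs obs M OX.1 + 1), 2 ^ N * (μs ^ N + (1 + vs ^ N * ((2 * N - 1).doubleFactorial : ℝ))))
          * (max 1 (ρ₀ * ((phi0 legs obs M OX.1 + N₀ : ℕ) : ℝ))) ^ phi0 legs obs M OX.1)
      (fun OX => ∏ j ∈ OX.1.filter (fun j => j ∈ bdry), Bl ^ (obs j).length)
      (fun OX => nfreeOf oc OX.2) θ 1 := by
  have hp : 0 < p := zero_lt_one.trans_le hp1
  have hKV : 0 ≤ KV := (abs_nonneg _).trans (hV fun _ => 0)
  have hΛ : ∀ O : Finset κ, 0 ≤ (max 1 ((Bs.card : ℝ) * (max 1 cg * (max 1 (phi0 legs obs M O : ℝ)) ^ cg))) ^ phi0 legs obs M O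
      * ∑ N ∈ range (phi0 legs obs M O + 1), 2 ^ N * (μs ^ N + (1 + vs ^ N * ((2 * N - 1).doubleFactorial : ℝ))) :=
    fun O => mul_nonneg (pow_nonneg (zero_le_one.trans (le_max_left _ _)) _) (Finset.sum_nonneg fun N _ => by positivity)
  exact ineq312_remainder_bdry (oc := oc) (vc := vc) (reg := reg) hPD hθ0 hθ1 hBl hB0 hρ hcV0 (inv_pos.mpr hp).le
    (inv_le_one_of_one_le₀ hp1) hθv hθv1 hθw hθw1 hB hBf hBz hcV hobs hlegs hloc hwalk hvert hρ₀0 hρ₀ hN hKV hΛ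
    (fun O t ht h0 => (prodCutoff_hE hPD Bs hℓ hg hgc hV hp hμs hvs hobsm hlegsm O t ht h0).trans (le_of_eq (by ring)))
    bdry hbeat

end Law

/-! ## §5  Kernel non-vacuity with a REAL cutoff profile -/

section Toy

open BIJ88Sect5Statements (CutoffProfile)
open BIJ88VertexIbp311 (vpoly)
open BIJ88WalkIneq312NonVacuity (toy_prec_posDef)

/-- **NON-VACUITY OF `ineq312_remainder_bdry_prodCutoff` WITH A GENUINE PROFILE**: on the one-site toy of
`BIJ88WalkIneq312NonVacuity` (`α = I = κ = β = P = Unit`, `W = {()}`, `Δ = 1`, `ℱ = 0`, one observable with the leg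
`e = 1`, no vertex, `Cov ≡ 0` non-triggering, `Dir = univ`, `B′ = ρ = ρ₀ = N₀ = 0`, `B_ℓ = θ = θ_v = θ_w = 1`, `M = 1`,
`bdry = {()}`) with the cutoff `χ(ψ) = χ₁(ψ(site)/1)` built from ANY printed profile `χ₁ : CutoffProfile` ((5.2.3) with
constant `c_g`; inhabited by p04's `gevreyCutoff`), `K_V = 1`, `p = 1`, `μ_* = 0`, `v_* = max(e·prec⁻¹e, 0)`: every
hypothesis of §4 is discharged by the kernel except the profile's own (5.2.3) letter `hgc`.
[cite: BalabanImbrieJaffe1988, §5.14 p.312 (estimate preceding (5.14.5)); (5.2.3) p.278] -/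
theorem ineq312_remainder_bdry_prodCutoff_toy (χp : CutoffProfile) {cg : ℝ}
    (hgc : ∀ (n : ℕ) (x : ℝ), |iteratedDeriv n χp.χ₁ x| ≤ cg ^ n * (n : ℝ) ^ (cg * n)) :
    BIJ88Sect5StatementsPart4.Ineq312 (remSys Unit Unit)
      (fun OX => remAt (prec (fun _ : Unit => ()) (1 : Matrix Unit Unit ℝ) ({()} : Finset Unit) (corner ℝ ({()} : Finset Unit)))
          (fun _ : Unit => (0 : Matrix {x : Unit // (fun _ : Unit => ()) x ∈ ({()} : Finset Unit)}
            {x : Unit // (fun _ : Unit => ()) x ∈ ({()} : Finset Unit)} ℝ)) (fun _ => false)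
          (src (fun _ : Unit => ()) (0 : Unit → ℝ) ({()} : Finset Unit)) (fun _ : Fin 0 => (0 : ℝ)) (fun _ : Fin 0 => [])
          (fun _ : Unit => [fun _ => (1 : ℝ)]) 1
          (fun ψ => ∏ b ∈ (univ : Finset Unit), χp.χ₁ ((1 : ℝ)⁻¹ *
            (fun _ : Unit => (ContinuousLinearMap.proj ⟨(), Finset.mem_singleton_self ()⟩ :
              ({x : Unit // (fun _ : Unit => ()) x ∈ ({()} : Finset Unit)} → ℝ) →L[ℝ] ℝ)) b ψ))
          (fun _ : Unit => (∅ : Finset Unit)) (fun _ : Fin 0 => (∅ : Finset Unit)) (fun _ => (∅ : Finset Unit)) [] 0 OX.1 OX.2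
        / ∫ φ, weight (prec (fun _ : Unit => ()) (1 : Matrix Unit Unit ℝ) ({()} : Finset Unit) (corner ℝ ({()} : Finset Unit))) φ
            * source (src (fun _ : Unit => ()) (0 : Unit → ℝ) ({()} : Finset Unit)) φ)
      (fun OX => (1 : ℝ) * ((max 1 (((univ : Finset Unit).card : ℝ) * (max 1 cg
              * (max 1 (phi0 (fun _ : Fin 0 => ([] : List ({x : Unit // (fun _ : Unit => ()) x ∈ ({()} : Finset Unit)} → ℝ)))
                (fun _ : Unit => [fun _ => (1 : ℝ)]) 1 OX.1 : ℝ)) ^ cg)))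
            ^ phi0 (fun _ : Fin 0 => ([] : List ({x : Unit // (fun _ : Unit => ()) x ∈ ({()} : Finset Unit)} → ℝ)))
                (fun _ : Unit => [fun _ => (1 : ℝ)]) 1 OX.1
          * ∑ N ∈ range (phi0 (fun _ : Fin 0 => ([] : List ({x : Unit // (fun _ : Unit => ()) x ∈ ({()} : Finset Unit)} → ℝ)))
                (fun _ : Unit => [fun _ => (1 : ℝ)]) 1 OX.1 + 1),
            2 ^ N * ((0 : ℝ) ^ N + (1 + (max ((fun _ => (1 : ℝ)) ⬝ᵥ
              ((prec (fun _ : Unit => ()) (1 : Matrix Unit Unit ℝ) ({()} : Finset Unit) (corner ℝ ({()} : Finset Unit)))⁻¹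
                *ᵥ fun _ => (1 : ℝ))) 0) ^ N * ((2 * N - 1).doubleFactorial : ℝ))))
        * (max 1 (0 * ((phi0 (fun _ : Fin 0 => ([] : List ({x : Unit // (fun _ : Unit => ()) x ∈ ({()} : Finset Unit)} → ℝ)))
            (fun _ : Unit => [fun _ => (1 : ℝ)]) 1 OX.1 + 0 : ℕ) : ℝ)))
          ^ phi0 (fun _ : Fin 0 => ([] : List ({x : Unit // (fun _ : Unit => ()) x ∈ ({()} : Finset Unit)} → ℝ)))
            (fun _ : Unit => [fun _ => (1 : ℝ)]) 1 OX.1)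
      (fun OX => ∏ _j ∈ OX.1.filter (fun j => j ∈ ({()} : Finset Unit)),
        (1 : ℝ) ^ ([fun _ : {x : Unit // (fun _ : Unit => ()) x ∈ ({()} : Finset Unit)} => (1 : ℝ)]).length)
      (fun OX => nfreeOf (fun _ : Unit => (∅ : Finset Unit)) OX.2) 1 1 := by
  have hsrc : src (fun _ : Unit => ()) (0 : Unit → ℝ) ({()} : Finset Unit) = 0 := by funext x; simp [src]
  have hV : ∀ φ : {x : Unit // (fun _ : Unit => ()) x ∈ ({()} : Finset Unit)} → ℝ,
      |vexp (fun _ : Fin 0 => (0 : ℝ)) (fun _ : Fin 0 => []) φ| ≤ 1 := fun φ => by simp [vexp, vpoly]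
  refine ineq312_remainder_bdry_prodCutoff (β := Unit) (Dir := Set.univ) (B' := fun _ => 0) (ρ := fun _ => 0)
    (cV := fun _ => 0) toy_prec_posDef univ (fun _ => norm_proj_le_one _) χp.smooth hgc hV le_rfl le_rfl
    (le_max_right _ _) (fun _ w hw => ?_) (fun m => m.elim0) one_pos le_rfl le_rfl (fun _ => le_rfl) (fun _ => le_rfl)
    (fun m => m.elim0) one_pos le_rfl one_pos le_rfl (fun _ u _ w _ => by simp) (fun _ u _ => by simp)
    (fun _ u _ => by simp) (fun m => m.elim0) (fun _ _ _ => Set.mem_univ _) (fun m => m.elim0)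
    (fun _ _ => ⟨zero_le_one, rfl⟩) (fun _ h => absurd h Bool.false_ne_true) (fun m => m.elim0) le_rfl
    (fun u _ => by simp) (fun _ u _ => by simp) ({()} : Finset Unit) (fun O t _ _ X _ => by simp)
  rw [List.mem_singleton] at hw; subst hw
  rw [hsrc, Matrix.mulVec_zero, dotProduct_zero, abs_zero]
  exact ⟨le_rfl, le_max_left _ _⟩

end Toy

end Literature.MathematicalPhysics.QuantumFieldTheory.BalabanImbrieJaffe1984to88.BIJ88WalkProductCutoff312

end
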